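/-
Copyright (c) 2026 H21 harness. All rights reserved.
Released under Apache 2.0 license as described in the file LICENSE.
-/
import Summits.ResolutionOfSingularities.ResolutionOfSingularities.Theorems.FrobeniusClosingSteerHevLeafSpineInd
import HarnessLib

/-!
# Sketch-hev-leaf-v3.1 — the [hEv-∞]ᴵ leaf RE-CUT OVER `IsMaxGenAt` (RULINGS 185b / 188b(iii) / 190a / 196b / 204a), idea-2 gen 13 (hEv-leaf pen)

TREE FILING (res-D-pv-035 g8 on res-L0-w41-plan-1 RULINGS 206(f)/207(d), `--supports stmt-ResolutionOfSingularities-16345 --as helper`):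
this module is res-L0-w41-idea-2 g13ʼs `L/res-L0-w41-idea-2/g13/Sketch-hev-leaf-v3_1.lean` **cc3b20fe656ea9fe** = the (MAX)ᴵ-cut WORDS OF RECORD
(res-L0-w41-tri-2 ONE-HUNK CHECK 2026-08-27T17:28:43Z PASS; tri-1 TRIAGE v6.26 R-V3; RULING 206(f)), BYTE-IDENTICAL from `set_option` to the
end (nine declarations: seven `def … : Prop` words + two pure-logic glues); only this paragraph and the «engine reading» markers below are
added to the module header. The ENGINE READING (E-LR) sentences of this header are an UNAUDITED engine reading of idea-2 (memo §10,
`g13/Sketch-hev-keyform-cert.lean`, certificate `StrippingTailKeyFormConclTwoN`) — NOT part of the words of record, booked for ROW R-KF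
(tri-1 / tri-3) by RULING 206(f) note (4); they are kept here only as marked context.

v3.1 = v3 (87fd32076ef53dc1; audits of record tri-1 TRIAGE v6.26 R-V3, tri-2 TRIAGE v30 R-HV3, RULING 204(a)) + the TWO one-line repairs of
RULING 204(a): (V3-2) the (SHIELD) conclusion and the matching (SHIELD⇒Concl) binder now read `IsPointStep R P i → ¬ NoSingularSurfaceAt R s p i →
LicensedShieldAt R s p i` (SURFACE-licensed point steps only: tri-1ʼs legal (MAX) binary member `σ³τ + x⁵ + y⁵` has `V(J)` = the τ-axis, no
singular surface, `LicensedShieldAt` false); (202(d)/tri-2 A6) docstrings: LICENSED shield (a `Q²`-congruence) ≠ LETTER/PENCIL shield, carrier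
events are licensed trivially, tri-3ʼs `N_{p,q;i,j}` satisfies (SHIELD)ʼs conclusion, (CERT)ʼs small-parameter junk is an immediate exit.
Signatures of (SH)ᴵ, (MAX)ᴵ, `LicensedShieldAt`, `TrinomialTauFormAt`, (CERT) and both glues are byte-unchanged.

OURS (campaign `res-hironaka`, rung L ★L-G4, slot W4.1). Replaces the role of NOTHING in the manuscript under review
[claim: Hironaka2017, status: under-review]; these are the campaignʼs OWN words; nothing is attributed to its author; nothing is a
Literature fact; AI review is weaker than expert review. WORDS + PURE-LOGIC GLUE ONLY — no proof claims. Companion memo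
`L/res-L0-w41-idea-2/g13/HEV-LEAF-V3.md`.

WHAT DIED (RULING 185a, CHAIN NEGATIVE): my `CarrierLemmaFour` / every bounded-lag local carrier lemma — the legal, event-free,
binary-order-4 corner chain `σ³τ + x′wτ³ + x′³w²τ → corner → corner → …` (tri-1 v6.21 `CARRIER-FALSIFIER.md`, tri-3 R-AJ, and my own
independent seed chain, kit j284638). The [hEv-∞] leaf is therefore re-cut, following LEMMA M (strat-2 `STRAT2-MEMO-1.md` §20, RULING 190a):

* **(SH)ᴵ `StrippingTailSwitchingEvenInfShadowConclIndTwoN`** — [hEv-∞]ᴵ + «infinitely many point-step generators are NOT maximal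
  (`¬ IsMaxGenAt (R i) 2 t (s i)`)» ⇒ `Concl`. ENGINE (strat-2 LEMMA M): a non-maximal member carries the square form
  `f = a² + b² f*`, `b ∈ 𝔪ᵢ²` at a σ_top point step (M2), so the shadow datum `(A₀ᵢ, √f*)` has first cleaned order ≤ 2e − 4 and is
  handed to `hbelow` (M4) — modulo the slack word W_min for e ≥ 4 (RULING 196a; e = 2 EMPTY by (M3″), e = 3 by (C2)).
* **(MAX)ᴵ `StrippingTailSwitchingEvenInfMaxConclIndTwoN`** — [hEv-∞]ᴵ + «eventually every point-step generator IS maximal» ⇒ `Concl`.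
  THE FRONTIER (RULING 196a R3). At e = 2 it IS [hEv-∞-4]ᴵ ((M3″): every point-step member of half-order 2 is maximal). INHABITED:
  the τ-shield family `τ(σ^{2e−1} + xyτ^{2e−2} + x^a y^b)` (tri-3 R-AJ; tri-1 v6.21 #4; my N₂), where `Concl` holds (toric).
* glue `strippingTailSwitchingEvenInfConclIndTwoN_of_shadow_of_max : (SH)ᴵ → (MAX)ᴵ → [hEv-∞]ᴵ` (excluded middle; PROVED).

ON THE (MAX) BRANCH (RULING 196b: the shield question is DYNAMIC; strat-2ʼs local separating member f_ex has a licensing surface Σ of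
embedding dimension 4):

* **`LicensedShieldAt R s p i`** — member `i` has a LICENSING singular prime `Q` of the radicand (`IsSingPrime`, `dim (R i ⧸ Q) = 2`: a
  singular SURFACE, the σ_top licence for a point step in the [hEv-∞] regime, strat-2 §21.2) with `Q ⊄ 𝔪ᵢ²`. LOCAL DICTIONARY (memo §3, by
  hand): `Q ⊄ 𝔪ᵢ²` ⟺ `Q` contains an order-one element `ℓ` ⟺ `V(Q)` lies inside the smooth hypersurface `V(ℓ)` ⟺ emb.dim `(R i ⧸ Q) ≤ 3`
  ⟺ `Q = (ℓ, M)` is a complete intersection (then `Q⁽²⁾ = Q²` and `IsSingPrime Q` ⟺ `∃ c ∉ Q, g, c² f − g² ∈ (ℓ², ℓM, M²)`, i.e.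
  `c² f = g² + ℓ(ℓA′ + M B′) + M² C′`): the LICENSED shield — a `Q²`-congruence, up to the `Q`-unit `c` and the `M²`-term — which is (E-dyn-1)
  «licensing surfaces eventually inside smooth hypersurfaces» of 196b in tree words and is WEAKER than the letter/pencil shield «`u ∣ f − g²`,
  `ord u = 1`» of 185b/188b(iii): tri-3ʼs `N_{p,q;i,j} = xyτ³ + στw + (1 + xⁱyʲ)w²`, `w = σ² + xᵖy^q` (`Q = (τ, w)`, `M²C′ = xⁱyʲw² ≠ 0`)
  is licensed, not letter-shielded (RULING 201(g)/202(d)); carrier events are licensed trivially; this is the word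
* **(SHIELD) `StrippingTailSwitchingEvenInfMaxShieldTwoN`** — on a (MAX) tail, EVENTUALLY every SURFACE-LICENSED point-step member
  (`¬ NoSingularSurfaceAt`, v3.1) is `LicensedShieldAt`. FRONTIER (tri-3 R-AL, dynamic forcing; the local converse is FALSE, 196b).
* **(SHIELD⇒Concl) `StrippingTailSwitchingEvenInfMaxShieldConclIndTwoN`** — a (MAX) tail whose surface-licensed point steps are eventually
  shielded yields `Concl`. FRONTIER, NO GENERAL ENGINE (memo §5: after `T := c t + g` the germ is `T² = ℓ·M̃ + M²C′`, a purely inseparable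
  double cover — wild; embedded resolution of the branch divisor would not suffice in characteristic 2). ENGINE READING («engine reading, unaudited» — RULING 206(f) note (4); E-LR, memo §10):
  LICENCE RE-EMBEDDING — adjoin the licence key form `W = M` and test the complete intersection `{W − M, T² − (c²f − g²)}` for
  ν-nondegeneracy; certificate `StrippingTailKeyFormConclTwoN` (`Sketch-hev-keyform-cert.lean`) covers tri-3ʼs `N` for every valuation.
* glue `…InfMaxConclIndTwoN_of_shield : (SHIELD) → (SHIELD⇒Concl) → (MAX)ᴵ` (PROVED, trivial).
* **THE ONE CERTIFICATE WITH AN ENGINE: `TrinomialTauFormAt` / `StrippingTailTrinomialConclTwoN`** — if at SOME member the cleaned radicand is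
  the τ-shield TRINOMIAL `x₄ (c₁ x₃^{2e−1} + c₂ x₁ x₂ x₄^{2e−2} + c₃ x₁^A x₂^B)` in a regular system of parameters, constants `cᵢ ∈ kˣ`,
  `¬ (A odd ∧ B odd)`, then `Concl`. ENGINE: the trinomial (with `T²`) is NEWTON-NONDEGENERATE in the characteristic-free log-Jacobian
  sense (memo §4: the only degenerate face is the edge `{x₁x₂x₄^{2e−1}, x₁^A x₂^B x₄}`, degenerate iff `A`, `B` are both odd = the
  square-event region), so ONE monomial local blowing up in `(x, sᵢ)` adapted to the cone of `ν` makes the torsor germ regular at the centre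
  and `SteeredExit.concl_of_exit` concludes; this covers EVERY booked (MAX) inhabitant `f_{e;a,b}` for EVERY valuation (not only the
  toric-LU witness of tri-1 §4 / tri-3 R-AJ). Kernel size L. Constants, not units: a unit coefficient that is a square (e.g. `(1+z)²`)
  makes a non-compact face degenerate — in characteristic 2 nondegeneracy is read MODULO SQUARES (memo §4.4).

Tags: «(folklore)» on `def … : Prop` words, «[folklore]» on proved glue (gate `relocate` lint). Imports the landed spine
`…HevLeafSpineInd` (p548331) only.
-/

set_option linter.dupNamespace false

open IsLocalRing
open Literature.AlgebraicGeometry.Resolution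
open Summit.ResolutionOfSingularities.ResolutionOfSingularities.Theorems.SwitchingDichotomy.Words
open Summit.ResolutionOfSingularities.ResolutionOfSingularities.Theorems.SteerRankThinness (Concl HasProperCoarsening)
open Summit.ResolutionOfSingularities.ResolutionOfSingularities.Theorems.SwitchingDichotomy.ArithReduction

namespace Summit.ResolutionOfSingularities.ResolutionOfSingularities.Theorems.SwitchingDichotomy.HevLeaf

section MaxCut

variable {K : Type} [Field K]

/-- **(MAX)ᴵ `StrippingTailSwitchingEvenInfMaxConclIndTwoN`** = [hEv-∞]ᴵ `StrippingTailSwitchingEvenInfConclIndTwoN` (…HevLeafSpineInd, p548331) VERBATIM + ONE binder before `hbelow`: «eventually every point-step generator is MAXIMAL» (`∃ i₀, ∀ i ≥ i₀, IsPointStep R P i → IsMaxGenAt (R i) p t (s i)`, …Words03Phases l.73). THE FRONTIER of the hEv leaf (RULING 196a R3); at half-order e = 2 it is [hEv-∞-4]ᴵ itself ((M3″) `isMaxGenAt_of_point_step_four`: every point-step member of cleaned order 4 is maximal). INHABITED by the eternal τ-shield family (tri-3 R-AJ / tri-1 v6.21 #4 / idea-2 N₂), on which `Concl` holds (`StrippingTailTrinomialConclTwoN`).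 Why it might fail: an eternal legal (MAX) tail whose members are eventually ν-DEGENERATE modulo squares, where no toric exit exists. OURS. (folklore) -/
def StrippingTailSwitchingEvenInfMaxConclIndTwoN : Prop :=
  ∀ p : ℕ, p = 2 →
    ∀ (k K : Type) [Field k] [CharP k p] [PerfectField k] [Field K] [Algebra k K]
    (O : ValuationSubring K) (A₀ : Subalgebra k K) (h₀ : A₀.toSubring ≤ O.toSubring) (t : K),
    CoreDatum p 4 k K O A₀ h₀ t → ¬ HasProperCoarsening O →
    ∀ (R : ℕ → Subring K) (P : (i : ℕ) → Ideal (R i)) (s : ℕ → K),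
      R 0 = locAtCentre A₀.toSubring O → NormalAt O (R 0) p t → IsSteeredRun O R P t p s →
      (¬ ∃ i₀ c : ℕ, 1 ≤ c ∧ IsDominantTail R P i₀ c) →
      (∃ i₀ : ℕ, ∀ i, i₀ ≤ i → IsHighOrderAt R s p i) →
      ¬ HeightTwoStepsInfinite R P → {j | IsPosStep R P j}.Infinite →
      (∀ i₀ : ℕ, ∃ i, i₀ ≤ i ∧ IsPointStep R P i ∧
        ∀ hs : s i ^ p ∈ R i, ¬ HasIsolatedSingularity (RadicandRing (R i) p ⟨s i ^ p, hs⟩)) →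
      (¬ ∃ i₀ : ℕ, ∃ x : K, x ≠ 0 ∧ x ∈ O ∧ O.valuation x < 1 ∧
        ∀ i, i₀ ≤ i → ∀ y ∈ R i, O.valuation y < 1 → ∃ j, i < j ∧ y / x ∈ R j) →
      (∃ i₀ : ℕ, ∀ i, i₀ ≤ i → ¬ OddCleanedPointStepAt R P s p i) →
      (∃ i₀ e : ℕ, 2 ≤ e ∧ ∀ i, i₀ ≤ i → IsPointStep R P i → BinaryResiduePointStepAt R P s p (2 * e) i) →
      (∀ i₀ : ℕ, ∃ i i' : ℕ, i₀ ≤ i ∧ IsSatellitePair R P i i') →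
      (∃ i₀ : ℕ, ∀ i i' : ℕ, i₀ ≤ i → IsSatellitePair R P i i' → ¬ NoSingularSurfaceAt R s p i') →
      (∃ i₀ : ℕ, ∀ i, i₀ ≤ i → IsPointStep R P i → IsMaxGenAt (R i) p t (s i)) →
      OrderInduction.ConclBelowDatum p k K O A₀ t →
      Concl O A₀ t

/-- **(SH)ᴵ `StrippingTailSwitchingEvenInfShadowConclIndTwoN`** = [hEv-∞]ᴵ VERBATIM + ONE binder before `hbelow`: «infinitely many point-step generators are NOT maximal» (`∀ i₀, ∃ i ≥ i₀, IsPointStep R P i ∧ ¬ IsMaxGenAt (R i) p t (s i)`). ENGINE = strat-2ʼs LEMMA M (`STRAT2-MEMO-1.md` §20; (M1) `MaxGenDictionary.not_isMaxGenAt_iff_nonunit_form`, (M2)–(M4) `MaxGenShadow.*`, RULING 190a/194d): a non-maximal member has `s i = a + b·s″` with `b ∈ 𝔪ᵢ`, indeed `b ∈ 𝔪ᵢ²` at a σ_top point step (M2), so `f = a² + b² f*` and the SHADOW datum `(A₀ᵢ, s″)` over the same `O` has first cleaned order ≤ 2e − 4 < 2e and is a core datum or concludes (`concl_or_coreDatum`),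 whence `hbelow` (M4) — modulo the slack word W_min for e ≥ 4 (RULING 196a: e = 2 EMPTY by (M3″), e = 3 discharged by (C2) `NoClimbFromOrderTwoTwoN`). Why it might fail: only through W_min (EFO₃ restricted to eternal even tails, e ≥ 4; FRONTIER-UNINSTANTIATED). OURS. (folklore) -/
def StrippingTailSwitchingEvenInfShadowConclIndTwoN : Prop :=
  ∀ p : ℕ, p = 2 →
    ∀ (k K : Type) [Field k] [CharP k p] [PerfectField k] [Field K] [Algebra k K]
    (O : ValuationSubring K) (A₀ : Subalgebra k K) (h₀ : A₀.toSubring ≤ O.toSubring) (t : K),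
    CoreDatum p 4 k K O A₀ h₀ t → ¬ HasProperCoarsening O →
    ∀ (R : ℕ → Subring K) (P : (i : ℕ) → Ideal (R i)) (s : ℕ → K),
      R 0 = locAtCentre A₀.toSubring O → NormalAt O (R 0) p t → IsSteeredRun O R P t p s →
      (¬ ∃ i₀ c : ℕ, 1 ≤ c ∧ IsDominantTail R P i₀ c) →
      (∃ i₀ : ℕ, ∀ i, i₀ ≤ i → IsHighOrderAt R s p i) →
      ¬ HeightTwoStepsInfinite R P → {j | IsPosStep R P j}.Infinite →
      (∀ i₀ : ℕ, ∃ i, i₀ ≤ i ∧ IsPointStep R P i ∧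
        ∀ hs : s i ^ p ∈ R i, ¬ HasIsolatedSingularity (RadicandRing (R i) p ⟨s i ^ p, hs⟩)) →
      (¬ ∃ i₀ : ℕ, ∃ x : K, x ≠ 0 ∧ x ∈ O ∧ O.valuation x < 1 ∧
        ∀ i, i₀ ≤ i → ∀ y ∈ R i, O.valuation y < 1 → ∃ j, i < j ∧ y / x ∈ R j) →
      (∃ i₀ : ℕ, ∀ i, i₀ ≤ i → ¬ OddCleanedPointStepAt R P s p i) →
      (∃ i₀ e : ℕ, 2 ≤ e ∧ ∀ i, i₀ ≤ i → IsPointStep R P i → BinaryResiduePointStepAt R P s p (2 * e) i) →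
      (∀ i₀ : ℕ, ∃ i i' : ℕ, i₀ ≤ i ∧ IsSatellitePair R P i i') →
      (∃ i₀ : ℕ, ∀ i i' : ℕ, i₀ ≤ i → IsSatellitePair R P i i' → ¬ NoSingularSurfaceAt R s p i') →
      (∀ i₀ : ℕ, ∃ i, i₀ ≤ i ∧ IsPointStep R P i ∧ ¬ IsMaxGenAt (R i) p t (s i)) →
      OrderInduction.ConclBelowDatum p k K O A₀ t →
      Concl O A₀ t

/-- **THE RE-CUT (PROVED, pure logic): [hEv-∞]ᴵ ⟸ (SH)ᴵ ∧ (MAX)ᴵ** — excluded middle on «eventually every point-step generator is maximal».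
OURS. [folklore] -/
theorem strippingTailSwitchingEvenInfConclIndTwoN_of_shadow_of_max
    (hSh : StrippingTailSwitchingEvenInfShadowConclIndTwoN)
    (hMax : StrippingTailSwitchingEvenInfMaxConclIndTwoN) :
    StrippingTailSwitchingEvenInfConclIndTwoN := by
  intro p hp2 k K _ _ _ _ _ O A₀ h₀ t core hrk R P s hR0 hN hrun hnd hhigh h2 hinf hwild hsw hev hbin hsat hsing hbelow
  by_cases hmax : ∃ i₀ : ℕ, ∀ i, i₀ ≤ i → IsPointStep R P i → IsMaxGenAt (R i) p t (s i)
  · exact hMax p hp2 k K O A₀ h₀ t core hrk R P s hR0 hN hrun hnd hhigh h2 hinf hwild hsw hev hbin hsat hsing hmax hbelow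
  · push Not at hmax
    exact hSh p hp2 k K O A₀ h₀ t core hrk R P s hR0 hN hrun hnd hhigh h2 hinf hwild hsw hev hbin hsat hsing hmax hbelow

/-- **`LicensedShieldAt R s p i`** — member `i` carries a LICENSING SINGULAR SURFACE INSIDE A SMOOTH HYPERSURFACE: a prime `Q` of `R i` with
`dim (R i ⧸ Q) = 2`, singular for the radicand `s i ^ p` (`IsSingPrime`: the torsor germ over `(R i)_Q` is not regular — the σ_top licence for a POINT
step in the [hEv-∞] regime, strat-2 `STRAT2-MEMO-1.md` §21.2), and `Q ⊄ 𝔪ᵢ²`, i.e. `Q` contains an element of order one. LOCAL DICTIONARY (memo §3):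
for `R i` regular local, `Q ⊄ 𝔪ᵢ²` ⟺ `∃ ℓ ∈ Q ∖ 𝔪ᵢ²` ⟺ `Q = (ℓ, M)` with `ℓ` a regular parameter (so `V(Q) ⊆ V(ℓ)` smooth, emb.dim `R i ⧸ Q ≤ 3`,
`Q⁽²⁾ = Q²`), and then `IsSingPrime … Q` ⟺ `∃ c ∉ Q, ∃ g, c²·f − g² ∈ Q⁽²⁾ = (ℓ², ℓ·M, M²)`, i.e. `c²·f = g² + ℓ(ℓA′ + M B′) + M²C′`
— the LICENSED shield: a `Q²`-congruence, read up to the `Q`-unit `c` and the `M²`-term (memo §3.5). It is NOT the letter/pencil shield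
«`u ∣ f − g²`, `ord u = 1`» of 185b/188b(iii): tri-3ʼs `N_{p,q;i,j} = xyτ³ + στw + (1 + xⁱyʲ)w²`, `w = σ² + xᵖy^q`, is licensed by
`Q = (τ, w)` (`c = 1`, `g = w`, `M²C′ = xⁱyʲw²`) and is not letter-shielded; tri-1ʼs `F_{a,b} = σ³τ + x(τ² + xᵃyᵇ)²` is licensed by
`Q = (σ, τ² + xᵃyᵇ)` (tri-2 R-HV3 A3). CARRIER EVENTS satisfy it trivially (`f − g² = ℓ·h`, `ord ℓ = 1`, `h ∈ 𝔪ᵢ`: take `Q = (ℓ, M)` with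
`M` a prime divisor of `h` modulo `ℓ`; tri-1 V3-3). It FAILS on strat-2ʼs `f_ex` (licensing surface Σ = {(u,v²,v³,uv)} of embedding
dimension 4, `P_Σ ⊆ 𝔪²`: licensed by a surface, NOT by one inside a smooth hypersurface) and on tri-1ʼs legal (MAX) binary member
`σ³τ + x⁵ + y⁵` (`V(J)` = the τ-axis: no singular surface at all). OURS. (folklore) -/
def LicensedShieldAt (R : ℕ → Subring K) (s : ℕ → K) (p i : ℕ) : Prop :=
  ∀ hs : s i ^ p ∈ R i, ∃ (_ : IsLocalRing (R i)) (Q : Ideal (R i)) (_ : Q.IsPrime),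
    IsSingPrime (R i) p ⟨s i ^ p, hs⟩ Q ∧ ringKrullDim (R i ⧸ Q) = 2 ∧ ¬ Q ≤ maximalIdeal (R i) ^ 2

/-- **(SHIELD) `StrippingTailSwitchingEvenInfMaxShieldTwoN`** — DYNAMIC SHIELD FORCING (RULING 196b re-scope of 185b/188b(iii); tri-3 R-AL (E-dyn-1) «licensing surfaces eventually inside smooth hypersurfaces»): on an eternal [hEv-∞] tail whose point-step generators are eventually maximal, EVENTUALLY every SURFACE-LICENSED point-step member (`¬ NoSingularSurfaceAt R s p i`: the radicand has SOME singular prime of coheight 2 — v3.1, tri-1 V3-2 / RULING 204(a); without it the word would silently assert a singular surface at every late point step, refuted as an implicit claim by tri-1ʼs legal (MAX) binary member `σ³τ + x⁵ + y⁵`, `V(J)` = the τ-axis) is `LicensedShieldAt` (licensed by a singular surface INSIDE A SMOOTH HYPERSURFACE). SATISFIED by tri-3ʼs eternal legal unshielded family `N_{p,q;i,j}` (`Q = (τ, w)`) and by tri-1ʼs `F_{a,b}` (`Q = (σ, τ² + xᵃyᵇ)`) — these are test objects for (SHIELD⇒Concl), not refutations of (SHIELD) (RULING 201(g)). The LOCAL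 converse is FALSE (strat-2 §21 `f_ex`: licensing surface Σ = {(u,v²,v³,uv)} of embedding dimension 4, legal point step, (MAX), binary order 4 — it leaves the window at the next step); any proof must use eternity. Curve-licensed point steps (no singular surface) are OUTSIDE this word: tri-1ʼs question «can curve-licensed point steps recur for ever on a (MAX) tail?» is tri-3ʼs F2-M (RULING 204(a)). Why it might fail: an eternal legal (MAX) tail surface-licensed for ever by emb.dim-4 surfaces. OURS. (folklore) -/
def StrippingTailSwitchingEvenInfMaxShieldTwoN : Prop :=
  ∀ p : ℕ, p = 2 →
    ∀ (k K : Type) [Field k] [CharP k p] [PerfectField k] [Field K] [Algebra k K]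
    (O : ValuationSubring K) (A₀ : Subalgebra k K) (h₀ : A₀.toSubring ≤ O.toSubring) (t : K),
    CoreDatum p 4 k K O A₀ h₀ t → ¬ HasProperCoarsening O →
    ∀ (R : ℕ → Subring K) (P : (i : ℕ) → Ideal (R i)) (s : ℕ → K),
      R 0 = locAtCentre A₀.toSubring O → NormalAt O (R 0) p t → IsSteeredRun O R P t p s →
      (¬ ∃ i₀ c : ℕ, 1 ≤ c ∧ IsDominantTail R P i₀ c) →
      (∃ i₀ : ℕ, ∀ i, i₀ ≤ i → IsHighOrderAt R s p i) →
      ¬ HeightTwoStepsInfinite R P → {j | IsPosStep R P j}.Infinite →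
      (∀ i₀ : ℕ, ∃ i, i₀ ≤ i ∧ IsPointStep R P i ∧
        ∀ hs : s i ^ p ∈ R i, ¬ HasIsolatedSingularity (RadicandRing (R i) p ⟨s i ^ p, hs⟩)) →
      (¬ ∃ i₀ : ℕ, ∃ x : K, x ≠ 0 ∧ x ∈ O ∧ O.valuation x < 1 ∧
        ∀ i, i₀ ≤ i → ∀ y ∈ R i, O.valuation y < 1 → ∃ j, i < j ∧ y / x ∈ R j) →
      (∃ i₀ : ℕ, ∀ i, i₀ ≤ i → ¬ OddCleanedPointStepAt R P s p i) →
      (∃ i₀ e : ℕ, 2 ≤ e ∧ ∀ i, i₀ ≤ i → IsPointStep R P i → BinaryResiduePointStepAt R P s p (2 * e) i) →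
      (∀ i₀ : ℕ, ∃ i i' : ℕ, i₀ ≤ i ∧ IsSatellitePair R P i i') →
      (∃ i₀ : ℕ, ∀ i i' : ℕ, i₀ ≤ i → IsSatellitePair R P i i' → ¬ NoSingularSurfaceAt R s p i') →
      (∃ i₀ : ℕ, ∀ i, i₀ ≤ i → IsPointStep R P i → IsMaxGenAt (R i) p t (s i)) →
      ∃ i₀ : ℕ, ∀ i, i₀ ≤ i → IsPointStep R P i → ¬ NoSingularSurfaceAt R s p i → LicensedShieldAt R s p i

/-- **(SHIELD⇒Concl) `StrippingTailSwitchingEvenInfMaxShieldConclIndTwoN`** = (MAX)ᴵ + «eventually every surface-licensed point-step member is `LicensedShieldAt`» (v3.1 binder, same hypothesis `¬ NoSingularSurfaceAt R s p i` as (SHIELD)) ⇒ `Concl`. FRONTIER, NO GENERAL ENGINE: with `Q = (ℓ, M)` and `c² f − g² ∈ (ℓ², ℓM, M²)` the germ is, after `T := c t + g`, the purely inseparable double cover `T² = ℓ·M̃ + M²·C′`; in characteristic 2 an embedded resolution of the branch divisor does NOT resolve the cover (`T² = u`, `u` a unit ≡ square mod 𝔪², is singular), so this word is the (MAX) frontier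 minus the dynamic shield question, not less. ENGINE READING (E-LR, memo §10, Teissier-style): LICENCE RE-EMBEDDING — adjoin the licence key form `W = M` as a new coordinate and read ν-nondegeneracy of the complete intersection `{W − M, T² − (c²f − g²)}`; by-hand certificates: `StrippingTailTrinomialConclTwoN` (the τ-shield trinomial, letter-shielded case `C′ = 0`) and `StrippingTailKeyFormConclTwoN` (`Sketch-hev-keyform-cert.lean`: tri-3ʼs `N_{p,q;i,j}`, the `M²C′ ≠ 0` case, `Concl` for EVERY rank-one valuation through every member — one gauge per parity class, kit j285167 / j285329). The OPEN content is therefore a tail whose members are, for the runʼs valuation, ν-DEGENERATE in every licence re-embedding — tri-3ʼs F2-M. Why it might fail: as (MAX)ᴵ. OURS. (folklore) -/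
def StrippingTailSwitchingEvenInfMaxShieldConclIndTwoN : Prop :=
  ∀ p : ℕ, p = 2 →
    ∀ (k K : Type) [Field k] [CharP k p] [PerfectField k] [Field K] [Algebra k K]
    (O : ValuationSubring K) (A₀ : Subalgebra k K) (h₀ : A₀.toSubring ≤ O.toSubring) (t : K),
    CoreDatum p 4 k K O A₀ h₀ t → ¬ HasProperCoarsening O →
    ∀ (R : ℕ → Subring K) (P : (i : ℕ) → Ideal (R i)) (s : ℕ → K),
      R 0 = locAtCentre A₀.toSubring O → NormalAt O (R 0) p t → IsSteeredRun O R P t p s →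
      (¬ ∃ i₀ c : ℕ, 1 ≤ c ∧ IsDominantTail R P i₀ c) →
      (∃ i₀ : ℕ, ∀ i, i₀ ≤ i → IsHighOrderAt R s p i) →
      ¬ HeightTwoStepsInfinite R P → {j | IsPosStep R P j}.Infinite →
      (∀ i₀ : ℕ, ∃ i, i₀ ≤ i ∧ IsPointStep R P i ∧
        ∀ hs : s i ^ p ∈ R i, ¬ HasIsolatedSingularity (RadicandRing (R i) p ⟨s i ^ p, hs⟩)) →
      (¬ ∃ i₀ : ℕ, ∃ x : K, x ≠ 0 ∧ x ∈ O ∧ O.valuation x < 1 ∧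
        ∀ i, i₀ ≤ i → ∀ y ∈ R i, O.valuation y < 1 → ∃ j, i < j ∧ y / x ∈ R j) →
      (∃ i₀ : ℕ, ∀ i, i₀ ≤ i → ¬ OddCleanedPointStepAt R P s p i) →
      (∃ i₀ e : ℕ, 2 ≤ e ∧ ∀ i, i₀ ≤ i → IsPointStep R P i → BinaryResiduePointStepAt R P s p (2 * e) i) →
      (∀ i₀ : ℕ, ∃ i i' : ℕ, i₀ ≤ i ∧ IsSatellitePair R P i i') →
      (∃ i₀ : ℕ, ∀ i i' : ℕ, i₀ ≤ i → IsSatellitePair R P i i' → ¬ NoSingularSurfaceAt R s p i') →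
      (∃ i₀ : ℕ, ∀ i, i₀ ≤ i → IsPointStep R P i → IsMaxGenAt (R i) p t (s i)) →
      (∃ i₀ : ℕ, ∀ i, i₀ ≤ i → IsPointStep R P i → ¬ NoSingularSurfaceAt R s p i → LicensedShieldAt R s p i) →
      OrderInduction.ConclBelowDatum p k K O A₀ t →
      Concl O A₀ t

/-- **(MAX)ᴵ ⟸ (SHIELD) ∧ (SHIELD⇒Concl)** (PROVED, trivial). OURS. [folklore] -/
theorem strippingTailSwitchingEvenInfMaxConclIndTwoN_of_shield
    (hF : StrippingTailSwitchingEvenInfMaxShieldTwoN)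
    (hC : StrippingTailSwitchingEvenInfMaxShieldConclIndTwoN) :
    StrippingTailSwitchingEvenInfMaxConclIndTwoN := by
  intro p hp2 k K _ _ _ _ _ O A₀ h₀ t core hrk R P s hR0 hN hrun hnd hhigh h2 hinf hwild hsw hev hbin hsat hsing hmax hbelow
  exact hC p hp2 k K O A₀ h₀ t core hrk R P s hR0 hN hrun hnd hhigh h2 hinf hwild hsw hev hbin hsat hsing hmax
    (hF p hp2 k K O A₀ h₀ t core hrk R P s hR0 hN hrun hnd hhigh h2 hinf hwild hsw hev hbin hsat hsing hmax) hbelow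

end MaxCut

/-! ## The one certificate with an engine: the Newton-nondegenerate τ-shield TRINOMIAL -/

section Trinomial

variable {K : Type} [Field K]

/-- **`TrinomialTauFormAt k S f e`** — in the local ring `S` (a member of the run) the radicand `f` is, after gauge `f − g²`, the τ-SHIELD TRINOMIAL
of half-order `e` in a regular system of parameters `x = (x₀, x₁, x₂, x₃)` («(z, y, σ, τ)»):
`f − g² = x₃ · (c₁ x₂^(2e−1) + c₂ x₀ x₁ x₃^(2e−2) + c₃ x₀^A x₁^B)` with CONSTANT coefficients `cᵢ ∈ kˣ` and `¬ (A odd ∧ B odd)`.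
This is EXACTLY the booked (MAX) inhabitant family `f_{e;a,b}` (tri-3 R-AJ `check_shield_family.py`; tri-1 v6.21 #4 `f₄ = τ″(σ″³ + xy″τ″² + x³y″⁴)`;
idea-2 `N₂ = σ³τ + x′wτ³ + x′³w²τ`, kit j284638), closed under its corner/satellite steps `(A,B) ↦ (A+B+1−2e, B | A)` away from the square-event
region (A, B odd) and the cube-event region. NEWTON-NONDEGENERATE (with `T²`, characteristic-free log-Jacobian form; memo §4): every face function
has no singular zero on the torus except the edge `{x₀x₁x₃^(2e−1), x₀^A x₁^B x₃}`, degenerate iff `A`, `B` are both odd. Constants, not units: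
`(1+x₀)²` as a coefficient would make a non-compact face degenerate (nondegeneracy is read modulo squares in characteristic 2). OURS. (folklore) -/
def TrinomialTauFormAt (k : Type) [Field k] [Algebra k K] (S : Subring K) [IsLocalRing S] (f : S) (e : ℕ) : Prop :=
  ∃ (x : Fin 4 → S) (g : S) (c₁ c₂ c₃ : k) (A B : ℕ), IsRsopPart x ∧ c₁ ≠ 0 ∧ c₂ ≠ 0 ∧ c₃ ≠ 0 ∧ ¬ (Odd A ∧ Odd B) ∧
    ((f : K) - (g : K) ^ 2 =
      (x 3 : K) * (algebraMap k K c₁ * (x 2 : K) ^ (2 * e - 1) + algebraMap k K c₂ * (x 0 : K) * (x 1 : K) * (x 3 : K) ^ (2 * e - 2) +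
        algebraMap k K c₃ * (x 0 : K) ^ A * (x 1 : K) ^ B))


/-- **(CERT) `StrippingTailTrinomialConclTwoN`** — a steered run (p = 2, n = 4, rank one) that at SOME member carries the τ-shield trinomial `TrinomialTauFormAt` concludes: `Concl O A₀ t`. ENGINE (toric resolution of a Newton-nondegenerate germ, restricted to the cone of ν; [Khovanskii 1977; Varchenko 1976; Oka 1997, Ch. III] for the statement in characteristic 0 — the proof is characteristic-free because the exponent matrix of a regular cone is unimodular, memo §4): let `w = (ν(x₀), …, ν(x₃), ν(sᵢ)) ∈ ℝ⁵₊` (rank one); take a regular cone `C ∋ w` of a fan refining the normal fan of the Newton polyhedron of `T² + (f − g²)`; the chart `(R i)[y₁, …, y₅]` (`y` = the dual-basis Laurent monomials in `(x, sᵢ + g′)`, all of ν-value ≥ 0) is ONE local blowing up of a monomial ideal, contains `A₀` and `t`, and its localisation at the centre of `ν` is regular by the face test; `SteeredExit.concl_of_exit` (or the definition of `Concl` directly) finishes. Covers EVERY booked (MAX) inhabitant for EVERY valuation. Intended regime `e ≥ 2`, `A + B ≥ 2e` (untyped and not needed: dominated exponents never lie on a compact face); at `e ≤ 1` or `A = B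 = 0` the ℕ-subtraction makes `f − g² = x₃·(unit)` or a nondegenerate binomial — an immediate regular/A₁ exit, `Concl` trivially (memo §4.5; tri-2 R-HV3 A4). Kernel size L (case split on the cone of ν). Why it might fail: only a typing slip (it is a theorem by hand; face test re-derived independently by tri-1 V3-4 and tri-2 R-HV3 T). OURS. (folklore) -/
def StrippingTailTrinomialConclTwoN : Prop :=
  ∀ p : ℕ, p = 2 →
    ∀ (k K : Type) [Field k] [CharP k p] [PerfectField k] [Field K] [Algebra k K]
    (O : ValuationSubring K) (A₀ : Subalgebra k K) (h₀ : A₀.toSubring ≤ O.toSubring) (t : K),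
    CoreDatum p 4 k K O A₀ h₀ t → ¬ HasProperCoarsening O →
    ∀ (R : ℕ → Subring K) (P : (i : ℕ) → Ideal (R i)) (s : ℕ → K),
      R 0 = locAtCentre A₀.toSubring O → NormalAt O (R 0) p t → IsSteeredRun O R P t p s →
      ∀ i e : ℕ, (∀ hs : s i ^ p ∈ R i, ∃ _ : IsLocalRing (R i), TrinomialTauFormAt k (R i) ⟨s i ^ p, hs⟩ e) →
      Concl O A₀ t

end Trinomial

end Summit.ResolutionOfSingularities.ResolutionOfSingularities.Theorems.SwitchingDichotomy.HevLeaf
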